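import Summits.ABC.StewartYu.ArchG3RecEndCNum
import Summits.ABC.StewartYu.GenThreeFrameSpecArchW
import HarnessLib

/-!
# The archimedean record of reference `ArchG3Rec` DELIVERS `RecordArchW` (clauses (A), (B), (C), (N)) — the content of the
# r2 line's stub `stub_recordArch` (crux `ArchCoreRat`, stmt-ABC-20502; plan R41/R42; parcel (r2-c), seat p4 g10)

Support file (theorems only; no named facts, no definitions). Cell `abc-stewartyu`, route `YuMatveevShapeRat`.
For every rank `n ≥ 2`, every constant `c ≥ 2^100` and every archimedean record `P : ArchG3Rec n`, the record obligations
`GenThreeFrameSpecArchW.RecordArchW (c^·) Y n P.A P.D₀ P.S₀ P.X_fin P.D` hold at the slack function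
`Y = RecordExits.Yslack (C_bⁿK) n` (depending on `n` only):

* (A) exit A refuted — ✓ `ArchG3Rec.exitA` (p1) through `RecordExits.clauseA_of_lt` with `D_max = L/2^{n+23} + 1` (`D_le`);
* (B) full rank refuted — ✓ `ArchG3Rec.exitB_all` (p1, all `n ≥ 2`) through `RecordExits.clauseB_of_lt`;
* (C) the covolume clause on the capped letters — `ArchG3Rec.exitC` (`ArchG3RecEndC`, heavy/light selections);
* (N) the numeric clauses — `ArchG3Rec.clauseN` (`ArchG3RecEndCNum`, `NCarch(n,r)` by kernel arithmetic + exponent count).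

`ArchG3Rec.recordArchW` assembles them; `ArchG3Rec.recordSupplyArch` is the REGISTERED TEXT of the r2 skeleton's stub
`Sig.stub_recordArch` (`∀ n ≥ 2, ∃ Y, ∀ c ≥ 2^100, ∀ P, RecordArchW (c^·) Y n P.A P.D₀ P.S₀ P.Xfin P.D`) proved BY NAME.

WHAT THIS IS NOT: not the START / letter lines / packs of the r2 line (stubs of p1 / lp-1 / p5); no crux moves by itself.

## References
* [Nesterenko2003] Yu. V. Nesterenko, LNM 1819 (2003) — §5.2 (5.13)–(5.22), Lemmas 5.3–5.4 (pp. 99–106).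
* [Matveev2000] E. M. Matveev, Izv. Math. 64 (2000) — (1.3).
-/

noncomputable section

open Finset Real
open Literature.NumberTheory.Transcendental
open Literature.NumberTheory.Transcendental.GaGm
open Summit.ABC.StewartYu.GenThreeFrameSpecArchW (RecordArchW)

namespace Summit.ABC.StewartYu

namespace ArchG3Rec

open PadicG3Par (Cb Cb_pos)
open ArchG3Par (K K_pos)

variable {n : ℕ} (P : ArchG3Rec n)

/-- **`ArchG3Rec` DELIVERS `RecordArchW`** (`n ≥ 2`, `c ≥ 2^100`): clauses (A), (B), (C), (N) at the letters
`(A, D₀, S₀, X_fin, D)` and the slack function `Y = RecordExits.Yslack (C_bⁿK) n`.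
[cite: Nesterenko2003, §5.2 (5.13)–(5.22), Lemmas 5.3–5.4] [cite: Matveev2000, (1.3); shape only] -/
theorem recordArchW (hn2 : 2 ≤ n) {c : ℝ} (hc : (2 : ℝ) ^ 100 ≤ c) :
    RecordArchW (fun r => c ^ r) (RecordExits.Yslack (Cb ^ n * K n) n) n P.A P.D₀ P.S₀ P.Xfin P.D := by
  have hD1 : ∀ j, 1 ≤ P.D j := P.end_floors.2.1
  refine ⟨?_, ?_, P.exitC hn2, ArchG3Rec.clauseN hc⟩
  · exact RecordExits.clauseA_of_lt hD1 P.D_le P.exitA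
  · exact RecordExits.clauseB_of_lt hD1 (P.exitB_all hn2)

/-- **THE RECORD STUB OF THE r2 LINE, BY NAME** (`Sig.stub_recordArch` of `Lines/arch_g3_frame.lean`, v4): for every rank
`n ≥ 2` a slack function `Y` (depending on `n` only) such that for every `c ≥ 2^100` and every `P : ArchG3Rec n` the record
obligations `RecordArchW (c^·) Y n P.A P.D₀ P.S₀ P.X_fin P.D` hold. [cite: Nesterenko2003, §5.2; shape only] -/
theorem recordSupplyArch : ∀ n : ℕ, 2 ≤ n → ∃ Y : ℕ → ℝ, ∀ c : ℝ, (2 : ℝ) ^ 100 ≤ c → ∀ P : ArchG3Rec n,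
    RecordArchW (fun r => c ^ r) Y n P.A P.D₀ P.S₀ P.Xfin P.D :=
  fun n hn => ⟨RecordExits.Yslack (Cb ^ n * K n) n, fun _ hc P => P.recordArchW hn hc⟩

end ArchG3Rec

end Summit.ABC.StewartYu

end
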